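import Mathlib
import HarnessLib
import Summits.NavierStokesRegularity.NavierStokesRegularity.Theses.IsobarTomography
import Summits.NavierStokesRegularity.NavierStokesRegularity.Cruxes.IsobaricLinesLiouville.StrategistCensus
import Summits.NavierStokesRegularity.NavierStokesRegularity.Theorems.IsobarTomographyIsobaricLinesLiouvilleHullReductionSix
import Literature.Analysis.FluidPDE.PartialRegularity

/-!
# Crux-strategist census, generation 2 (redirect r1) — typed sketches for `IsobaricLinesLiouville`
(stmt-NavierStokesRegularity-11741)

Companion of `STRATEGY-CENSUS.md` §R1 (planner-cstrat-stmt-NavierStokesRegularity-11741-r1-0,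
2026-08-17). Second-opinion census: nothing here is filed as an item. The file certifies, sorry-free,

* **Dec₃ (local normal form / globalisation / pressureless)** — the best typed split this seat could
  produce: `crux_of_dec3 : LocalNormalForm → HullGlobalisation → PressurelessLiouville →
  IsobaricLinesLiouville`, glued through the landed v8 assembly `isobaricLinesLiouville_of_hull5s`
  (p152686). The census explains why `LocalNormalForm` stays crux-sized (its truth in 3-D space-time
  hinges on an exceptional-family list nobody knows; as typed with the five hulls it may be false),
  while `HullGlobalisation` and `PressurelessLiouville` are honest smaller pieces.
* **The KNSS restriction is cosmetic** — `crux_iff_cruxOnKNSS : KNSSNormalisation →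
  (IsobaricLinesLiouville ↔ CruxOnKNSSLimits)`: restricting the crux to the only inputs the route's
  `closes` ever feeds it (KNSS blow-up limits, `|v| ≤ 1 = sup |v|`, smooth, measurable) does not
  weaken it, because the isobaric class is scale-invariant; `KNSSNormalisation` packages exactly the
  scaling-covariance and KNSS §4 regularity facts (named in its docstring).
* **The Type-I sub-crux** `CruxTypeI` (re-target recommendation for the tenure planner) and the
  corresponding instance `crux_of_typeISplit` of the gen-1 regime-split template, recording that the
  complement (Type-II-rate isobaric ancient solutions) is again engine-less.

References: KNSS 2009 (arXiv:0709.3599) §1, §4, Prop. 6.1; Albritton–Barker 2019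
(arXiv:1811.00502) Thm 1.1; Seregin 2014 (doi:10.1142/9314) pp. 113–114, 127–128;
Seregin–Silvestre–Šverák–Zlatoš 2012 (arXiv:1010.6025) Thm 1.3.
-/

noncomputable section

set_option linter.dupNamespace false

namespace Summit.NavierStokesRegularity.NavierStokesRegularity.Cruxes.IsobaricLinesLiouville.StrategistR1

open scoped InnerProductSpace RealInnerProductSpace Topology Laplacian ENNReal
open Literature.Analysis.FluidPDE Set
open Summit.NavierStokesRegularity.NavierStokesRegularity.Theses.IsobarTomography
open Summit.NavierStokesRegularity.NavierStokesRegularity.Cruxes.IsobaricLinesLiouville.Strategist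
open Summit.NavierStokesRegularity.NavierStokesRegularity.Theorems.IsobaricLinesLiouville.FluxSurfacePersistence

/-! ## Dec₃ — local normal form / globalisation / pressureless Liouville -/

/-- The five GLOBAL symmetry hulls (A) parallel vorticity / (B′) shear / (C) axisymmetric swirl-free /
(D) helical / (E) two stretch-free directions of line `Ideator2Sketch` v8 — verbatim the consequent of
its one open stub `stub_hullRigidity`. -/
def Hull5s (v : ℝ → EuclideanSpace ℝ (Fin 3) → EuclideanSpace ℝ (Fin 3)) : Prop :=
  (∃ a : EuclideanSpace ℝ (Fin 3), ∀ t < 0, ∀ x : EuclideanSpace ℝ (Fin 3),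
      ∃ μ : ℝ, curl (v t) x = μ • a) ∨
  (∃ a : EuclideanSpace ℝ (Fin 3), a ≠ 0 ∧ ∀ t < 0, ∀ (x : EuclideanSpace ℝ (Fin 3)) (δ : ℝ),
      ∃ μ : ℝ, v t (x + δ • a) - v t x = μ • a) ∨
  (∃ e c : EuclideanSpace ℝ (Fin 3), e ≠ 0 ∧ ∀ t < 0, ∀ x : EuclideanSpace ℝ (Fin 3),
      fderiv ℝ (v t) x (cross e (x - c)) = cross e (v t x) ∧ ⟪v t x, cross e (x - c)⟫_ℝ = 0) ∨
  (∃ a b c : EuclideanSpace ℝ (Fin 3), ⟪a, b⟫_ℝ ≠ 0 ∧ ∀ t < 0, ∀ x : EuclideanSpace ℝ (Fin 3),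
      cross (curl (v t) x) (cross a (x - c) + b) = 0 ∧ ⟪v t x, cross a (x - c) + b⟫_ℝ = 0) ∨
  (∃ e₁ e₂ : EuclideanSpace ℝ (Fin 3), cross e₁ e₂ ≠ 0 ∧ ∀ t < 0, ∀ x : EuclideanSpace ℝ (Fin 3),
      ⟪curl (v t) x, gradient (fun y => ⟪v t y, e₁⟫_ℝ) x⟫_ℝ = 0 ∧
      ⟪curl (v t) x, gradient (fun y => ⟪v t y, e₂⟫_ℝ) x⟫_ℝ = 0)

/-- The same five identities LOCALISED to a space-time set `U` (points `p = (t, x)`), with the shear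
hull (B′) in its infinitesimal form `∂_a v ∈ ℝ a` (the finite-difference form follows globally by
integrating along the line). This is the shape of a local normal form: an identity with CONSTANT
parameters holding on an open space-time set. -/
def HullOn (U : Set (ℝ × EuclideanSpace ℝ (Fin 3)))
    (v : ℝ → EuclideanSpace ℝ (Fin 3) → EuclideanSpace ℝ (Fin 3)) : Prop :=
  (∃ a : EuclideanSpace ℝ (Fin 3), ∀ p ∈ U, ∃ μ : ℝ, curl (v p.1) p.2 = μ • a) ∨
  (∃ a : EuclideanSpace ℝ (Fin 3), a ≠ 0 ∧ ∀ p ∈ U, ∃ μ : ℝ, fderiv ℝ (v p.1) p.2 a = μ • a) ∨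
  (∃ e c : EuclideanSpace ℝ (Fin 3), e ≠ 0 ∧ ∀ p ∈ U,
      fderiv ℝ (v p.1) p.2 (cross e (p.2 - c)) = cross e (v p.1 p.2) ∧
        ⟪v p.1 p.2, cross e (p.2 - c)⟫_ℝ = 0) ∨
  (∃ a b c : EuclideanSpace ℝ (Fin 3), ⟪a, b⟫_ℝ ≠ 0 ∧ ∀ p ∈ U,
      cross (curl (v p.1) p.2) (cross a (p.2 - c) + b) = 0 ∧ ⟪v p.1 p.2, cross a (p.2 - c) + b⟫_ℝ = 0) ∨
  (∃ e₁ e₂ : EuclideanSpace ℝ (Fin 3), cross e₁ e₂ ≠ 0 ∧ ∀ p ∈ U,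
      ⟪curl (v p.1) p.2, gradient (fun y => ⟪v p.1 y, e₁⟫_ℝ) p.2⟫_ℝ = 0 ∧
      ⟪curl (v p.1) p.2, gradient (fun y => ⟪v p.1 y, e₂⟫_ℝ) p.2⟫_ℝ = 0)

/-- The pressure gradient vanishes on the space-time set `U`. -/
def PressurelessOn (U : Set (ℝ × EuclideanSpace ℝ (Fin 3)))
    (q : ℝ → EuclideanSpace ℝ (Fin 3) → ℝ) : Prop :=
  ∀ p ∈ U, gradient (q p.1) p.2 = 0

/-- The open backward slab `(-∞,0) × ℝ³`. -/
def Slab : Set (ℝ × EuclideanSpace ℝ (Fin 3)) := Iio 0 ×ˢ univ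

/-- **Sub₁ — LNF (local normal form).** Every element of the isobaric class is, on SOME nonempty open
space-time subset of the slab, either pressureless or inside one of the five infinitesimal hulls.
(Informal content: the prolongation tower of `ω·∇q ≡ 0` along NS closes at a finite jet order with
exactly these exceptional families. Certified by the lead ONLY for axisymmetric space-time germs near
columnar / z-linear bases, REV 8; unknown — and possibly false as typed — in general.) -/
def LocalNormalForm : Prop :=
  ∀ v q, InClass v q → ∃ U : Set (ℝ × EuclideanSpace ℝ (Fin 3)),
    IsOpen U ∧ U.Nonempty ∧ U ⊆ Slab ∧ (PressurelessOn U q ∨ HullOn U v)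

/-- **Sub₂ — GLOB (globalisation).** A local alternative propagates to the whole slab: spatial
analyticity of bounded mild solutions (KNSS §4 / `NSBoundedMildAnalytic`) on each slice, time
analyticity or forward/backward uniqueness for the (linear, given `v`) vorticity equation across
slices, and integration of `∂_a v ∈ ℝa` along lines for (B′). -/
def HullGlobalisation : Prop :=
  ∀ v q, InClass v q → ∀ U : Set (ℝ × EuclideanSpace ℝ (Fin 3)),
    IsOpen U → U.Nonempty → U ⊆ Slab →
      (PressurelessOn U q → PressurelessOn Slab q) ∧ (HullOn U v → Hull5s v)

/-- **Sub₃ — HP (pressureless Liouville).** A bounded ancient mild solution whose pressure gradient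
vanishes on the slab (`∂ₜv + (v·∇)v = Δv`, `div v = 0`, hence `tr (∇v)² ≡ 0`) is slice-constant.
Honest small piece: implied by the crux (`pressureless_of_crux`); its LINEAR shadow (passive scalar
with a bounded divergence-free drift) is FALSE (Seregin–Silvestre–Šverák–Zlatoš 2012, Thm 1.3), so a
proof must use that the drift is the solution (`|v - b|²` are subsolutions with dissipation `-|∇v|²`). -/
def PressurelessLiouville : Prop :=
  ∀ v q, InClass v q → PressurelessOn Slab q → SliceConst v

/-- Slice-constant fields are in hull (A) with `a = 0`. -/
theorem hull5s_of_sliceConst {v : ℝ → EuclideanSpace ℝ (Fin 3) → EuclideanSpace ℝ (Fin 3)}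
    (h : SliceConst v) : Hull5s v := by
  left
  refine ⟨0, fun t ht x => ⟨0, ?_⟩⟩
  obtain ⟨b, hb⟩ := h t ht
  rw [hb, curl_const_eq_zero, zero_smul]

/-- Dec₃ delivers the global hull disjunction element-wise. -/
theorem hull5s_of_dec3 (h₁ : LocalNormalForm) (h₂ : HullGlobalisation) (h₃ : PressurelessLiouville)
    {v : ℝ → EuclideanSpace ℝ (Fin 3) → EuclideanSpace ℝ (Fin 3)}
    {q : ℝ → EuclideanSpace ℝ (Fin 3) → ℝ} (hc : InClass v q) : Hull5s v := by
  obtain ⟨U, hU, hne, hsub, hloc⟩ := h₁ v q hc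
  have hg := h₂ v q hc U hU hne hsub
  rcases hloc with hp | hh
  · exact hull5s_of_sliceConst (h₃ v q hc (hg.1 hp))
  · exact hg.2 hh

/-- **Glue of Dec₃** (logic + the landed v8 assembly `isobaricLinesLiouville_of_hull5s`, p152686):
`LNF → GLOB → HP → IsobaricLinesLiouville`. -/
theorem crux_of_dec3 (h₁ : LocalNormalForm) (h₂ : HullGlobalisation) (h₃ : PressurelessLiouville) :
    IsobaricLinesLiouville :=
  isobaricLinesLiouville_of_hull5s
    (fun _ _ hanc hcl hiso _ _ _ => hull5s_of_dec3 h₁ h₂ h₃ ⟨hanc, hcl, hiso⟩)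

/-- HP is a special case of the crux (`∇q ≡ 0` makes `ω·∇q ≡ 0` automatic): the split loses nothing
on this piece. -/
theorem pressureless_of_crux (h : IsobaricLinesLiouville) : PressurelessLiouville :=
  fun v q hc _ => (crux_iff.1 h) v q hc

/-- LNF is implied by the crux (slice-constant ⇒ hull (A) with `a = 0` on the whole slab), so it is
not stronger than the crux on class elements; what is unknown is a proof that avoids the crux. -/
theorem lnf_of_crux (h : IsobaricLinesLiouville) : LocalNormalForm := by
  intro v q hc
  refine ⟨Slab, isOpen_Iio.prod isOpen_univ, ⟨((-1 : ℝ), (0 : EuclideanSpace ℝ (Fin 3))), ?_⟩,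
    subset_rfl, Or.inr (Or.inl ⟨0, fun p hp => ⟨0, ?_⟩⟩)⟩
  · exact ⟨by norm_num [Slab], mem_univ _⟩
  · obtain ⟨b, hb⟩ := (crux_iff.1 h) v q hc p.1 hp.1
    rw [hb, curl_const_eq_zero, zero_smul]

/-! ## The KNSS restriction is cosmetic -/

/-- The crux restricted to the only inputs `closes` feeds it: KNSS blow-up limits
(`IsKNSSBlowupLimit`: bounded ancient mild, measurable slices, smooth, `|v| ≤ 1 = sup |v|`). -/
def CruxOnKNSSLimits : Prop :=
  ∀ (v : ℝ → EuclideanSpace ℝ (Fin 3) → EuclideanSpace ℝ (Fin 3))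
    (q : ℝ → EuclideanSpace ℝ (Fin 3) → ℝ),
    IsKNSSBlowupLimit v → IsClassicalNSSolutionOn (Set.Iio 0) 1 0 v q →
    (∀ t < 0, ∀ x : EuclideanSpace ℝ (Fin 3), ⟪curl (v t) x, gradient (q t) x⟫_ℝ = 0) →
    SliceConst v

theorem cruxOnKNSS_of_crux (h : IsobaricLinesLiouville) : CruxOnKNSSLimits :=
  fun v q hv hcl hiso => (crux_iff.1 h) v q ⟨hv.isBoundedAncientMildSolution, hcl, hiso⟩

/-- **KNSS normalisation of the isobaric class.** A non-slice-constant class element rescales, by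
`v ↦ nsRescale c v`, `q ↦ nsRescalePressure c q` with `c = 1 / sup |v|`, to a KNSS blow-up limit in
the class. Content: scale covariance of ancient mild solutions (`IsAncientMildSolution.nsRescale`,
KNSS §1) and of classical solutions (`IsClassicalNSSolutionOn.nsRescale`, Leray §20), scale
covariance of the pointwise identity `ω·∇q = 0` (chain rule: both factors pick up powers of `c` at
`(c²t, cx)`), KNSS §4 smoothness of bounded ancient mild solutions
(`KNSS2009_regularity_boundedWeak_ancient`, proved in tree), continuity ⇒ measurable slices, and
`sup |nsRescale c v| = c · sup |v| = 1`. A hypothesis here; every ingredient is a named tree fact. -/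
def KNSSNormalisation : Prop :=
  ∀ v q, InClass v q → ¬ SliceConst v → ∃ c : ℝ, 0 < c ∧
    IsKNSSBlowupLimit (nsRescale c v) ∧ InClass (nsRescale c v) (nsRescalePressure c q)

/-- Slice-constancy descends along the NS scaling. -/
theorem sliceConst_of_nsRescale {v : ℝ → EuclideanSpace ℝ (Fin 3) → EuclideanSpace ℝ (Fin 3)}
    {c : ℝ} (hc : 0 < c) (h : SliceConst (nsRescale c v)) : SliceConst v := by
  intro t ht
  have hs : t / c ^ 2 < 0 := div_neg_of_neg_of_pos ht (by positivity)
  obtain ⟨b, hb⟩ := h (t / c ^ 2) hs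
  refine ⟨c⁻¹ • b, funext fun y => ?_⟩
  have key := congrFun hb (c⁻¹ • y)
  simp only [nsRescale_apply] at key
  have hct : c ^ 2 * (t / c ^ 2) = t := by field_simp
  have hcy : c • (c⁻¹ • y) = y := by rw [smul_smul, mul_inv_cancel₀ hc.ne', one_smul]
  rw [hct, hcy] at key
  calc v t y = c⁻¹ • (c • v t y) := by rw [smul_smul, inv_mul_cancel₀ hc.ne', one_smul]
    _ = c⁻¹ • b := by rw [key]

theorem crux_of_cruxOnKNSS (hN : KNSSNormalisation) (h : CruxOnKNSSLimits) :
    IsobaricLinesLiouville := by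
  rw [crux_iff]
  intro v q hc
  by_contra hne
  obtain ⟨c, hc0, hK, hcl⟩ := hN v q hc hne
  exact hne (sliceConst_of_nsRescale hc0 (h _ _ hK hcl.2.1 hcl.2.2))

/-- **The restriction to KNSS limits is an equivalence** (modulo the normalisation facts): re-targeting
the crux to the outputs of `TubeAlternative` as they stand buys nothing. A re-target with teeth must
ADD structure to those outputs (e.g. the Type-I bound below), which is a route-level (tenure) move. -/
theorem crux_iff_cruxOnKNSS (hN : KNSSNormalisation) : IsobaricLinesLiouville ↔ CruxOnKNSSLimits :=
  ⟨cruxOnKNSS_of_crux, crux_of_cruxOnKNSS hN⟩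

/-! ## The Type-I sub-crux (re-target recommendation) and the Type-I regime split -/

/-- The Albritton–Barker Type-I bound on the isobaric class element `(v, q)`: `(v, q)` is suitable on
the slab with a weak spatial gradient `G` and `sup_{r>0, z.1<0} (A + C + D + E)(r, z) < ∞`
(`cknSum`; exactly the bound of `NontrivialTypeIAncientExists`). -/
def HasABTypeIBound (v : ℝ → EuclideanSpace ℝ (Fin 3) → EuclideanSpace ℝ (Fin 3))
    (q : ℝ → EuclideanSpace ℝ (Fin 3) → ℝ) : Prop :=
  ∃ G : ℝ → EuclideanSpace ℝ (Fin 3) → EuclideanSpace ℝ (Fin 3) →L[ℝ] EuclideanSpace ℝ (Fin 3),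
    IsSuitableWeakSolutionOn (slab (EuclideanSpace ℝ (Fin 3)) (Iio 0) isOpen_Iio) 1 0 v q ∧
    HasWeakSpatialGradientOn (slab (EuclideanSpace ℝ (Fin 3)) (Iio 0) isOpen_Iio) v G ∧
    (⨆ (r : ℝ) (_ : 0 < r) (z : ℝ × EuclideanSpace ℝ (Fin 3)) (_ : z.1 < 0), cknSum r z v q G) < ∞

/-- **K2′ — the Type-I isobaric Liouville theorem** (strictly weaker than the crux; the recommended
re-target, to be paired with a `TubeAlternative′` that outputs the Type-I bound). -/
def CruxTypeI : Prop :=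
  ∀ v q, InClass v q → HasABTypeIBound v q → SliceConst v

theorem cruxTypeI_of_crux (h : IsobaricLinesLiouville) : CruxTypeI :=
  fun v q hc _ => (crux_iff.1 h) v q hc

/-- **K2″ — the Type-II-rate complement**: isobaric class elements WITHOUT the Type-I bound are
slice-constant. No engine: this class contains every putative Type-II blow-up limit. -/
def CruxTypeIIRate : Prop :=
  ∀ v q, InClass v q → ¬ HasABTypeIBound v q → SliceConst v

/-- The Type-I instance of the gen-1 regime-split template (`crux_of_regimeSplit`, s1): lossless,
but the complement `CruxTypeIIRate` is the crux minus a thin (conjecturally empty!) subclass. -/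
theorem crux_of_typeISplit (h₁ : CruxTypeI) (h₂ : CruxTypeIIRate) : IsobaricLinesLiouville :=
  crux_of_regimeSplit HasABTypeIBound (fun v q hc hP => h₁ v q hc hP) (fun v q hc hP => h₂ v q hc hP)

end Summit.NavierStokesRegularity.NavierStokesRegularity.Cruxes.IsobaricLinesLiouville.StrategistR1

end
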